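import Mathlib
import Literature.Computability.Complexity.RangeAvoidance
import Literature.Computability.Complexity.SignDegreeXor
import Summits.PneNP.PneNP.Theorems.PstarIsolation
import Summits.PneNP.PneNP.Theorems.PstarIsolationBound

/-!
# Typed pure `P⋆` instances: the doubling reduction and the structure `Range = Cut ⊕ Clique`

FRONTIER range-avoidance ladder, rung F-N3 (cell `pnp-ideate`, ROUND-20 seed §2; restricted-model algorithmics — nothing
here bears on `P` vs `NP`).  For the pure predicate `P⋆(u) = u₀ ⊕ u₁ ⊕ u₂·u₃` call positions `0,1` the XOR slots and `2,3`
the AND slots.  An instance is TYPED when no variable occurs both in an XOR slot and in an AND slot.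

* DOUBLING (`typedDouble`): reading the XOR slots from a left copy and the AND slots from a right copy of the variables
  gives a typed pure instance `Ĩ` on `n + n` variables with the same `m` outputs and `Ĩ(x,x) = I(x)`
  (`eval_typedDouble_append`), so `Range(I) ⊆ Range(Ĩ)` (`range_subset_range_typedDouble`) and any point avoiding
  `Range(Ĩ)` avoids `Range(I)` (`not_mem_range_of_typedDouble`): pure-`P⋆` AVOID at stretch `C` reduces to TYPED
  pure-`P⋆` AVOID at stretch `C/2`, and typed instances are instances — the roof `PstarAvoidLinearFP` is its typed case
  (the string-level FP transfer is item T20.3 of the seed, not done here).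
* STRUCTURE (`mem_range_typed_iff`): for a typed pure instance, `y ∈ Range(I)` iff `y = cutVec T ⊕ cliqueVec S` for
  INDEPENDENT vertex sets `T, S` — the cut space of the XOR graph plus the induced-edge-set vectors of the AND graph.
* MECHANISM OF T3 = NO (`onesFlip_mem_range_of_typed_bipartite`): typed + every XOR pair cut by one set `T` (bipartite
  XOR graph) + pairwise distinct AND pairs ⇒ EVERY neighbour `1ᵐ ⊕ e_i` of the all-ones point is in the range
  (`T`, `S = {c_i, d_i}`); `PstarIsolationWorstCase.hub` is the instance `|T| = 1`.
-/

set_option linter.dupNamespace false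

open Finset Literature.Computability.Complexity
open Summit.PneNP.PneNP.Theorems.PstarIsolation
open Summit.PneNP.PneNP.Theorems.PstarIsolationBound (AllOnesIsolated)

namespace Summit.PneNP.PneNP.Theorems.PstarTyped

variable {n m : ℕ}

/-! ## Typed instances and the typed double -/

/-- A `P⋆` instance is TYPED when no variable occurs both in an XOR slot (positions `0,1`) and in an AND slot
(positions `2,3`), possibly of different outputs. -/
def Typed (I : LocalMap 4 n m) : Prop :=
  ∀ (j j' : Fin m) (s s' : Fin 4), s.val < 2 → 2 ≤ s'.val → I.vars j s ≠ I.vars j' s'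

/-- The instance class of the typed case of the roof: pure and typed. -/
def TypedPstar : ∀ ⦃n m : ℕ⦄, LocalMap 4 n m → Prop := fun _ _ I => I.IsPure xorAndPred ∧ Typed I

/-- Positions of the typed double on `n + n` variables: XOR slots read the left copy, AND slots the right copy. -/
def doubleVars (I : LocalMap 4 n m) (j : Fin m) (s : Fin 4) : Fin (n + n) :=
  if s.val < 2 then Fin.castAdd n (I.vars j s) else Fin.natAdd n (I.vars j s)

/-- **The typed double** `Ĩ` of `I`: `Ĩ(t,z)_j = t_a ⊕ t_b ⊕ z_c·z_d` on the variables `(t,z) ∈ {0,1}ⁿ⁺ⁿ`. -/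
def typedDouble (I : LocalMap 4 n m) : LocalMap 4 (n + n) m where
  vars := doubleVars I
  table := I.table

/-- An XOR slot of the double reads the left copy. -/
theorem doubleVars_of_lt (I : LocalMap 4 n m) (j : Fin m) {s : Fin 4} (hs : s.val < 2) :
    doubleVars I j s = Fin.castAdd n (I.vars j s) := by
  simp [doubleVars, hs]

/-- An AND slot of the double reads the right copy. -/
theorem doubleVars_of_le (I : LocalMap 4 n m) (j : Fin m) {s : Fin 4} (hs : 2 ≤ s.val) :
    doubleVars I j s = Fin.natAdd n (I.vars j s) := by
  simp [doubleVars, Nat.not_lt.2 hs]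

/-- Value of an XOR slot position of the double. -/
theorem doubleVars_val_of_lt (I : LocalMap 4 n m) (j : Fin m) {s : Fin 4} (hs : s.val < 2) :
    (doubleVars I j s).val = (I.vars j s).val := by
  rw [doubleVars_of_lt I j hs, Fin.val_castAdd]

/-- Value of an AND slot position of the double. -/
theorem doubleVars_val_of_le (I : LocalMap 4 n m) (j : Fin m) {s : Fin 4} (hs : 2 ≤ s.val) :
    (doubleVars I j s).val = n + (I.vars j s).val := by
  rw [doubleVars_of_le I j hs, Fin.val_natAdd]

/-- The typed double is typed. -/
theorem typedDouble_typed (I : LocalMap 4 n m) : Typed (typedDouble I) := by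
  intro j j' s s' hs hs' h
  have hv := congrArg Fin.val h
  change (doubleVars I j s).val = (doubleVars I j' s').val at hv
  rw [doubleVars_val_of_lt I j hs, doubleVars_val_of_le I j' hs'] at hv
  have := (I.vars j s).isLt
  omega

/-- The typed double of a pure instance is pure. -/
theorem typedDouble_isPure (I : LocalMap 4 n m) (hI : I.IsPure xorAndPred) :
    (typedDouble I).IsPure xorAndPred := by
  refine ⟨fun j => hI.1 j, fun j => ?_⟩
  intro s s' h
  have hv := congrArg Fin.val h
  change (doubleVars I j s).val = (doubleVars I j s').val at hv
  have h1 := (I.vars j s).isLt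
  have h2 := (I.vars j s').isLt
  by_cases hs : s.val < 2 <;> by_cases hs' : s'.val < 2
  · rw [doubleVars_val_of_lt I j hs, doubleVars_val_of_lt I j hs'] at hv
    exact hI.2 j (Fin.ext hv)
  · rw [doubleVars_val_of_lt I j hs, doubleVars_val_of_le I j (by omega)] at hv
    omega
  · rw [doubleVars_val_of_le I j (by omega), doubleVars_val_of_lt I j hs'] at hv
    omega
  · rw [doubleVars_val_of_le I j (by omega), doubleVars_val_of_le I j (by omega)] at hv
    exact hI.2 j (Fin.ext (by omega))

/-- The typed double of a pure instance is in the typed class. -/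
theorem typedPstar_typedDouble (I : LocalMap 4 n m) (hI : I.IsPure xorAndPred) : TypedPstar (typedDouble I) :=
  ⟨typedDouble_isPure I hI, typedDouble_typed I⟩

/-- Evaluating the typed double on the diagonal `(x, x)` gives back `I(x)`. -/
theorem eval_typedDouble_append (I : LocalMap 4 n m) (x : Fin n → Bool) :
    (typedDouble I).eval (Fin.append x x) = I.eval x := by
  funext j
  show I.table j (fun s => Fin.append x x (doubleVars I j s)) = I.table j (fun s => x (I.vars j s))
  congr 1
  funext s
  by_cases hs : s.val < 2
  · rw [doubleVars_of_lt I j hs, Fin.append_left]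
  · rw [doubleVars_of_le I j (by omega), Fin.append_right]

/-- **Range inclusion** `Range(I) ⊆ Range(Ĩ)`. -/
theorem range_subset_range_typedDouble (I : LocalMap 4 n m) : I.range ⊆ (typedDouble I).range := by
  rintro y ⟨x, rfl⟩
  exact ⟨Fin.append x x, eval_typedDouble_append I x⟩

/-- **The doubling reduction**: a point outside `Range(Ĩ)` is outside `Range(I)`. -/
theorem not_mem_range_of_typedDouble (I : LocalMap 4 n m) {y : Fin m → Bool}
    (hy : y ∉ (typedDouble I).range) : y ∉ I.range :=
  fun h => hy (range_subset_range_typedDouble I h)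

/-! ## `Range = Cut ⊕ Clique` for typed pure instances -/

/-- The cut vector of a vertex set `T` on the XOR pairs: `[a_j ∈ T] ⊕ [b_j ∈ T]`. -/
def cutVec (I : LocalMap 4 n m) (T : Finset (Fin n)) (j : Fin m) : Bool :=
  xor (decide (I.vars j 0 ∈ T)) (decide (I.vars j 1 ∈ T))

/-- The clique (induced-edge) vector of a vertex set `S` on the AND pairs: `[c_j ∈ S] ∧ [d_j ∈ S]`. -/
def cliqueVec (I : LocalMap 4 n m) (S : Finset (Fin n)) (j : Fin m) : Bool :=
  decide (I.vars j 2 ∈ S) && decide (I.vars j 3 ∈ S)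

/-- Every range point of a pure `P⋆` instance is the cut vector plus the clique vector of ONE set (the support of `x`). -/
theorem eval_eq_cut_xor_clique (I : LocalMap 4 n m) (hI : I.IsPure xorAndPred) (x : Fin n → Bool) :
    I.eval x = fun j =>
      xor (cutVec I (univ.filter fun v => x v = true) j) (cliqueVec I (univ.filter fun v => x v = true) j) := by
  funext j
  show I.table j (fun s => x (I.vars j s)) = _
  rw [hI.1 j, xorAndPred_apply]
  simp [cutVec, cliqueVec]

/-- **Structure of the range of a TYPED pure instance**: `y ∈ Range(I)` iff `y = cutVec T ⊕ cliqueVec S` for some vertex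
sets `T` and `S`, independent of each other (`Range = Cut(G_L) ⊕ Clique(G_A)`). -/
theorem mem_range_typed_iff (I : LocalMap 4 n m) (hI : I.IsPure xorAndPred) (hT : Typed I) (y : Fin m → Bool) :
    y ∈ I.range ↔ ∃ T S : Finset (Fin n), y = fun j => xor (cutVec I T j) (cliqueVec I S j) := by
  constructor
  · rintro ⟨x, rfl⟩
    exact ⟨_, _, eval_eq_cut_xor_clique I hI x⟩
  · rintro ⟨T, S, rfl⟩
    classical
    -- the mixed assignment: variables occurring in an XOR slot read `T`, all others read `S`
    let isX : Fin n → Prop := fun v => ∃ j : Fin m, ∃ s : Fin 4, s.val < 2 ∧ I.vars j s = v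
    refine ⟨fun v => if isX v then decide (v ∈ T) else decide (v ∈ S), funext fun j => ?_⟩
    have hx0 : isX (I.vars j 0) := ⟨j, 0, by decide, rfl⟩
    have hx1 : isX (I.vars j 1) := ⟨j, 1, by decide, rfl⟩
    have ha2 : ¬ isX (I.vars j 2) := fun ⟨j', s, hs, h⟩ => hT j' j s 2 hs (by decide) h
    have ha3 : ¬ isX (I.vars j 3) := fun ⟨j', s, hs, h⟩ => hT j' j s 3 hs (by decide) h
    show I.table j (fun s => if isX (I.vars j s) then decide (I.vars j s ∈ T) else decide (I.vars j s ∈ S)) = _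
    rw [hI.1 j, xorAndPred_apply]
    simp [hx0, hx1, ha2, ha3, cutVec, cliqueVec]

/-! ## The mechanism of `T3 = NO` in general -/

/-- **Typed + bipartite XOR graph + simple AND graph ⇒ every neighbour of `1ᵐ` is in the range.**  If one vertex set
`T` cuts every XOR pair and the AND pairs are pairwise distinct, then `1ᵐ ⊕ e_i = cutVec T ⊕ cliqueVec {c_i, d_i}`. -/
theorem onesFlip_mem_range_of_typed_bipartite (I : LocalMap 4 n m) (hI : I.IsPure xorAndPred) (hT : Typed I)
    (hbip : ∃ T : Finset (Fin n), ∀ j, cutVec I T j = true)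
    (hsimple : ∀ j j' : Fin m, I.vars j 2 ∈ ({I.vars j' 2, I.vars j' 3} : Finset (Fin n)) →
      I.vars j 3 ∈ ({I.vars j' 2, I.vars j' 3} : Finset (Fin n)) → j = j')
    (i : Fin m) : onesFlip i ∈ I.range := by
  obtain ⟨T, hTcut⟩ := hbip
  rw [mem_range_typed_iff I hI hT]
  refine ⟨T, {I.vars i 2, I.vars i 3}, funext fun j => ?_⟩
  rw [hTcut j]
  by_cases hj : j = i
  · subst hj
    rw [(onesFlip_eq_false_iff j j).2 rfl]
    simp [cliqueVec]
  · have hne : onesFlip i j ≠ false := fun h => hj ((onesFlip_eq_false_iff i j).1 h)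
    have ht : onesFlip i j = true := by
      cases h : onesFlip i j with
      | false => exact absurd h hne
      | true => rfl
    have hcf : cliqueVec I {I.vars i 2, I.vars i 3} j ≠ true := by
      intro h
      simp only [cliqueVec, Bool.and_eq_true, decide_eq_true_eq] at h
      exact hj (hsimple j i h.1 h.2)
    have hcf' : cliqueVec I {I.vars i 2, I.vars i 3} j = false := by
      cases h : cliqueVec I {I.vars i 2, I.vars i 3} j with
      | false => rfl
      | true => exact absurd h hcf
    rw [ht, hcf']
    rfl

/-- Hence such an instance (with at least one output) is never all-ones-isolated. -/
theorem not_allOnesIsolated_of_typed_bipartite (I : LocalMap 4 n m) (hI : I.IsPure xorAndPred) (hT : Typed I)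
    (hbip : ∃ T : Finset (Fin n), ∀ j, cutVec I T j = true)
    (hsimple : ∀ j j' : Fin m, I.vars j 2 ∈ ({I.vars j' 2, I.vars j' 3} : Finset (Fin n)) →
      I.vars j 3 ∈ ({I.vars j' 2, I.vars j' 3} : Finset (Fin n)) → j = j')
    (hm : 0 < m) : ¬ AllOnesIsolated I :=
  fun h => h ⟨0, hm⟩ (onesFlip_mem_range_of_typed_bipartite I hI hT hbip hsimple _)

end Summit.PneNP.PneNP.Theorems.PstarTyped
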